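import Mathlib.MeasureTheory.Function.SimpleFuncDenseLp
import Mathlib.MeasureTheory.Function.LpSpace.Indicator
import Mathlib.MeasureTheory.Measure.MeasuredSets
import Mathlib.MeasureTheory.Constructions.ProjectiveFamilyContent
import HarnessLib

/-!
# Bounded cylinder functions are dense among the `L^p` functions of a set of coordinates

Topic `Literature/Probability/LatticeModels`; theorems only (no definitions, no named facts).

On a product space `Π i, X i` with a finite measure `μ`, a real function `f ∈ L^p(μ)` (`p < ∞`)
which is measurable and depends only on the coordinates in a set `J ⊆ ι` (`DependsOn f J`) can be
approximated in `L^p(μ)` by BOUNDED measurable functions depending only on FINITELY many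
coordinates of `J` (bounded cylinder functions with base in `J`). This is the function version of
the approximation of events of `σ(x_j : j ∈ J)` by cylinder events (Mathlib's
`exists_measure_symmDiff_lt_of_generateFrom_isSetRing`), and is the standard device for passing
identities and estimates for local observables of lattice random fields (Gibbs measures, Markov
chains) from finite windows to half-lines / infinite regions, e.g. mixing bounds
`|Cov(f, g)| ≤ c ‖f‖₂ ‖g‖₂` for `f`, `g` measurable with respect to a past and a future σ-algebra.

* `measurable_extend_dite` — measurability of the extension of a configuration on `J` by a base
  point off `J`;
* `comp_extend_restrict_of_dependsOn` — a function of the coordinates in `J` factors through the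
  restriction to `J`;
* `exists_bounded_cylinder_eLpNorm_sub_le_of_dependsOn` — **the theorem**.

Proof: push forward to `Π j : J, X j` (the function factors measurably through the restriction),
apply Mathlib's `MemLp.induction_dense` there with the class of bounded cylinder functions, whose
base case is the approximation of measurable sets by measurable cylinders
(`generateFrom_measurableCylinders`, `isSetRing_measurableCylinders`), and pull back. [folklore]
-/

noncomputable section

open MeasureTheory Set Function Filter
open scoped ENNReal symmDiff

namespace Literature.Probability.LatticeModels

variable {ι : Type*} {X : ι → Type*} [∀ i, MeasurableSpace (X i)]

/-- The extension of a configuration on `J` by a fixed configuration `x₀` off `J` is measurable.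
[folklore] -/
theorem measurable_extend_dite (J : Set ι) [DecidablePred (· ∈ J)] (x₀ : Π i, X i) :
    Measurable fun (y : Π j : J, X j) (i : ι) => if h : i ∈ J then y ⟨i, h⟩ else x₀ i := by
  refine measurable_pi_lambda _ fun i => ?_
  by_cases h : i ∈ J
  · simp only [dif_pos h]
    exact measurable_pi_apply _
  · simp only [dif_neg h]
    exact measurable_const

omit [∀ i, MeasurableSpace (X i)] in
/-- A function depending only on the coordinates in `J` is unchanged when the coordinates off `J`
are replaced by those of a fixed configuration. [folklore] -/
theorem comp_extend_restrict_of_dependsOn {β : Type*} {f : (Π i, X i) → β} {J : Set ι}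
    [DecidablePred (· ∈ J)] (hf : DependsOn f J) (x₀ x : Π i, X i) :
    f (fun i => if h : i ∈ J then J.restrict x ⟨i, h⟩ else x₀ i) = f x :=
  hf fun i hi => by simp [hi]

/-- **Bounded cylinder functions with base in `J` are dense in the `L^p` functions of the
coordinates in `J`.** Let `μ` be a finite measure on `Π i, X i`, `p < ∞`, and `f : (Π i, X i) → ℝ`
measurable, depending only on the coordinates in `J`, with `f ∈ L^p(μ)`. Then for every `ε ≠ 0`
there are a finite `I ⊆ J` and a bounded measurable `g` depending only on the coordinates in `I`
with `‖f - g‖_{L^p(μ)} ≤ ε`. [folklore] -/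
theorem exists_bounded_cylinder_eLpNorm_sub_le_of_dependsOn [∀ i, Nonempty (X i)] {p : ℝ≥0∞}
    (hp : p ≠ ∞) {μ : Measure (Π i, X i)} [IsFiniteMeasure μ] {J : Set ι} {f : (Π i, X i) → ℝ}
    (hfm : Measurable f) (hfJ : DependsOn f J) (hfp : MemLp f p μ) {ε : ℝ≥0∞} (hε : ε ≠ 0) :
    ∃ (I : Finset ι) (g : (Π i, X i) → ℝ), ↑I ⊆ J ∧ Measurable g ∧ DependsOn g ↑I ∧
      (∃ B : ℝ, ∀ x, ‖g x‖ ≤ B) ∧ eLpNorm (f - g) p μ ≤ ε := by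
  classical
  set x₀ : Π i, X i := fun i => Classical.arbitrary (X i) with hx₀
  set ext : (Π j : J, X j) → Π i, X i := fun y i => if h : i ∈ J then y ⟨i, h⟩ else x₀ i
    with hext
  have hextm : Measurable ext := measurable_extend_dite J x₀
  have hres : Measurable (J.restrict : (Π i, X i) → Π j : J, X j) := Set.measurable_restrict J
  set fhat : (Π j : J, X j) → ℝ := f ∘ ext with hfhat
  have hfhatm : Measurable fhat := hfm.comp hextm
  have hcomp : fhat ∘ J.restrict = f := funext fun x => comp_extend_restrict_of_dependsOn hfJ x₀ x
  set ν : Measure (Π j : J, X j) := μ.map J.restrict with hν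
  have hfhatp : MemLp fhat p ν :=
    (memLp_map_measure_iff hfhatm.aestronglyMeasurable hres.aemeasurable).2 (by rw [hcomp]; exact hfp)
  -- the dense class of bounded cylinder functions on `Π j : J, X j`
  have hdense : ∃ g : (Π j : J, X j) → ℝ, eLpNorm (fhat - g) p ν ≤ ε ∧
      (Measurable g ∧ (∃ B : ℝ, ∀ y, ‖g y‖ ≤ B) ∧ ∃ I : Finset J, DependsOn g (I : Set J)) := by
    refine hfhatp.induction_dense hp _ ?_ ?_ (fun g hg => hg.1.aestronglyMeasurable) hε
    · -- base case: indicators of measurable sets are approximated by indicators of cylinders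
      intro c s hs _ δ hδ
      obtain ⟨η, hη, hηδ⟩ := exists_eLpNorm_indicator_le (μ := ν) hp c hδ
      have hcov : ∃ D : Set (Set (Π j : J, X j)), D.Countable ∧
          D ⊆ measurableCylinders (fun j : J => X j) ∧ ν (⋃₀ D)ᶜ = 0 :=
        ⟨{univ}, countable_singleton _, singleton_subset_iff.2 (univ_mem_measurableCylinders _),
          by simp⟩
      obtain ⟨t, ht, hts⟩ := exists_measure_symmDiff_lt_of_generateFrom_isSetRing (μ := ν)
        isSetRing_measurableCylinders hcov generateFrom_measurableCylinders.symm hs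
        (ENNReal.coe_pos.2 hη)
      obtain ⟨I, S, hS, rfl⟩ := (mem_measurableCylinders t).1 ht
      refine ⟨(cylinder I S).indicator fun _ => c, ?_,
        measurable_const.indicator (MeasurableSet.cylinder I hS), ⟨‖c‖, fun y => ?_⟩, I,
        fun y y' hyy' => dependsOn_cylinder_indicator_const S c hyy'⟩
      · rw [eLpNorm_indicator_sub_indicator]
        exact hηδ _ hts.le
      · exact norm_indicator_le_norm_self _ _
    · -- the class is closed under addition
      rintro g g' ⟨hgm, ⟨B, hB⟩, I, hI⟩ ⟨hg'm, ⟨B', hB'⟩, I', hI'⟩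
      refine ⟨hgm.add hg'm, ⟨B + B', fun y => (norm_add_le _ _).trans (add_le_add (hB y) (hB' y))⟩,
        I ∪ I', fun y y' hyy' => ?_⟩
      simp only [Pi.add_apply]
      rw [hI fun j hj => hyy' j (by simp [hj]), hI' fun j hj => hyy' j (by simp [hj])]
  obtain ⟨g, hgε, hgm, ⟨B, hB⟩, I, hI⟩ := hdense
  refine ⟨I.map (Embedding.subtype (· ∈ J)), g ∘ J.restrict, ?_, hgm.comp hres, ?_,
    ⟨B, fun x => hB _⟩, ?_⟩
  · intro i hi
    rw [Finset.coe_map] at hi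
    obtain ⟨j, -, rfl⟩ := hi
    exact j.2
  · intro x x' hxx'
    simp only [Function.comp_apply]
    refine hI fun j hj => hxx' j ?_
    simp only [Finset.coe_map, Embedding.coe_subtype, mem_image, Finset.mem_coe]
    exact ⟨j, hj, rfl⟩
  · have hsub : f - g ∘ J.restrict = (fhat - g) ∘ J.restrict := by rw [← hcomp]; rfl
    rw [hsub, ← eLpNorm_map_measure ((hfhatm.sub hgm).aestronglyMeasurable) hres.aemeasurable]
    exact hgε

end Literature.Probability.LatticeModels

end
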